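import Literature.NumberTheory.EllipticCurves.LPointPolarDegree
import HarnessLib

/-!
# The polar degree on `Hom(E, E')`: parallelogram law, positivity, and `#ker φ ∣ deg φ`

Trunk T-ELLARITH (group G16); notion `cm_endomorphisms_isogeny`. Last layer of the
divisor-theoretic degree route to the named fact `Literature.AlgebraicGeometry.Motives.linearIndependent_tateModule_map`
(Silverman, *AEC*, Thm. III.7.4), discharged in
`Literature.AlgebraicGeometry.Motives.FaltingsECProofs` (`linearIndependent_tateModule_map_holds`)
through `linearIndependent_tateModule_map_of_degree`, whose three inputs are proved here for the
**polar degree** `deg f := d(f(x, y))` (`polarDegHom`) of the `L`-point `f(x, y) ∈ E'(K̄(E))`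
attached to `f ∈ Hom_K(E, E')` (`homLPoint`; the generic image `φ(x, y)` of the isogeny `φ`
underlying `f`, *AEC* proof of Thm. III.6.2(c), and `O` for `f = 0`):

* `polarDegHom_parallelogram` — **`deg (f + g) + deg (f - g) = 2 deg f + 2 deg g`** on
  `Hom_K(E, E')` (*AEC* Cor. III.6.3), from `LPointPolarDegree.polarDeg_parallelogram` and the
  **additivity `(φ + ψ)(x, y) = φ(x, y) + ψ(x, y)`** of generic images (`homLPoint_add`);
* `polarDegHom_pos` — **`deg f > 0` for `f ≠ 0`** (*AEC* Thm. II.2.4(a) in the form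
  `deg φ ≥ 1`);
* `Isogeny.card_ker_dvd_polarDegHom` — **`#ker φ ∣ deg φ`** (*AEC* Thm. III.4.10(a),
  `#ker φ = deg_s φ`), here: for generic `P₀` the fibre of `φ(x, y)` over `φ(P₀)` is the coset
  `P₀ + ker φ` and the ramification index is constant on it (kernel translations `τ_T^*` fix
  `φ^* K̄(E')`, `FunctionFieldTranslation`, and transport `v_P` to `v_{P+T}`,
  `placeValuation_transAlgHom_of_ne`), so `deg φ = D(φ P₀) = #ker φ · e(P₀)`.

## The additivity of generic images

An `L`-point `X` of `E'` over `L = K̄(E)` is determined by its specialisations `X(P)` at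
infinitely many places (`eq_of_infinite_setOf_specialize_eq`: distinct `x`-coordinates have
distinct residues off a finite set; equal `x` and opposite `y` force `2X(P) = O'` infinitely
often). The generic image specialises to the values of the isogeny off the exceptional set of
its rational representation (`Isogeny.specialize_genericLPoint`, through the bridge
`HasValueAt.placeValuation_le_one_and_placeRes` between `FunctionFieldTranslation.HasValueAt` and
the residues of `WeierstrassPlaces`), and specialisation is additive off a finite set
(`finite_setOf_specialize_add_ne`, `finite_setOf_specialize_add_self_ne`: chords and tangents
specialise to chords and tangents at good places, *AEC* VII.2.1). Hence
`χ(x, y) = φ(x, y) + ψ(x, y)` whenever `χ = φ + ψ` on points (`Isogeny.genericLPoint_eq_add`), and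
with `Hom_K(E, E')` a group (the tree's `mem_homModule_iff_holds`, *AEC* III.§4) the map
`f ↦ f(x, y)` is additive on `Hom_K(E, E')`.

## Contents (all definitions are real)

* Generic (`V, V'` over `k`): `specialize_neg`, `eq_of_infinite_setOf_specialize_eq`,
  `finite_setOf_specialize_add_ne`, `placeValuation_slope_self_le_one_and_placeRes`,
  `finite_setOf_specialize_add_self_ne`.
* For `E = W`, `E' = W'` over `K`: `HasValueAt.placeValuation_le_one_and_placeRes`,
  **`Isogeny.genericLPoint φ = φ(x, y)`** (as an `L`-point of `E' ⊗ K̄` over `L = K̄(E)`, the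
  point type of `LPointPolarDegree`), `Isogeny.specialize_genericLPoint`,
  `Isogeny.genericLPoint_eq_add`, `Isogeny.genericLPoint_eq_neg`, **`homLPoint f`**,
  `homLPoint_add`, `homLPoint_neg`, `homLPoint_sub`, **`polarDegHom f`**,
  **`polarDegHom_parallelogram`**, **`polarDegHom_pos`**,
  `exists_hasValueAt_of_placeValuation_le_one`,
  `placeValuation_transAlgHom_of_ne` (`v_P ∘ τ_T^* = v_{P+T}`), `Isogeny.ramificationIdx_add_eq`,
  **`Isogeny.card_ker_dvd_polarDegHom`**.

## References

* [SilvermanAEC2009] J. H. Silverman, *The Arithmetic of Elliptic Curves*, 2nd ed., GTM 106,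
  Springer 2009: II.2.1, II.2.4(a), II.2.6(a), III.3.6, III.§4 (`Hom(E₁, E₂)` is a group,
  Thm. III.4.10), III.6.2–6.3, VII.2.1.

## Design choices

* `polarDegHom` is a total function on `Hom(E(K̄), E'(K̄))` (`0` off `Hom_K(E, E')`), the shape
  consumed by `FaltingsECProofs.linearIndependent_tateModule_map_of_degree`. It is not claimed to
  coincide with `IsogenyDegree.degHom` (`[K̄(E) : φ^* K̄(E')]`); that identification is the
  degree half of *AEC* II.2.6(a), not needed for Thm. III.7.4.
* On the point type of `E' ⊗ K̄` over `K̄(E)`, generic group lemmas are applied by `exact` with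
  explicit arguments rather than by `rw` (Mathlib's group structure on `Affine.Point` depends on
  a `DecidableEq` instance, and syntactic matching is fragile across the two base changes).
-/

noncomputable section

open scoped Classical WithZero AddSubgroup
open scoped Polynomial.Bivariate
open Polynomial IsDedekindDomain

universe u

namespace Literature.NumberTheory.EllipticCurves.WeierstrassFunctionField

open WeierstrassCurve

variable {k : Type u} [Field k]

section Unique

variable {V : WeierstrassCurve.Affine k} [V.IsElliptic] {V' : WeierstrassCurve.Affine k}
  [V'.IsElliptic]

/-- **Specialisation commutes with negation** (at every place). [folklore] -/
theorem specialize_neg (P : V.Point) (X : (V'.baseChange V.FunctionField).toAffine.Point) :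
    specialize V V' P (-X) = -specialize V V' P X := by
  cases X with
  | zero => rfl
  | some u w h =>
    rw [Affine.Point.neg_some]
    by_cases hu : placeValuation V P u ≤ 1
    · have hw := placeValuation_y_le_one h.left hu
      obtain ⟨ha₁, -, ha₃, -, -⟩ := placeValuation_baseChange_a_le_one (V' := V') P
      rw [specialize_some_of_le_one P _ hu, specialize_some_of_le_one P h hu, Affine.Point.neg_some,
        Affine.Point.some.injEq]
      refine ⟨rfl, ?_⟩
      have t1 : placeValuation V P (-w) ≤ 1 := by rwa [Valuation.map_neg]
      have t2 : placeValuation V P ((V'.baseChange V.FunctionField).toAffine.a₁ * u) ≤ 1 := by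
        rw [map_mul]; exact mul_le_one' ha₁ hu
      rw [Affine.negY, Affine.negY, placeRes_sub P (Valuation.map_sub_le _ t1 t2) ha₃,
        placeRes_sub P t1 t2, placeRes_neg P hw, placeRes_mul P ha₁ hu, baseChange_a₁,
        baseChange_a₃, placeRes_algebraMap, placeRes_algebraMap]
    · push Not at hu
      rw [specialize_some_of_one_lt P _ hu, specialize_some_of_one_lt P h hu, neg_zero]

/-- A constant `x`-coordinate is integral at every place (over an algebraically closed `k`).
[folklore] -/
theorem placeValuation_le_one_of_not_transcendental [IsAlgClosed k] (P : V.Point)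
    {u : V.FunctionField} (hu : ¬Transcendental k u) : placeValuation V P u ≤ 1 := by
  obtain ⟨c, rfl⟩ := exists_algebraMap_eq_of_isAlgebraic' (F := V.FunctionField) (not_not.mp hu)
  exact placeValuation_algebraMap_le_one P c

/-- **An `L`-point with `X(P) = O'` at infinitely many places is `O`.** [folklore] -/
theorem eq_zero_of_infinite_setOf_specialize_eq_zero [IsAlgClosed k]
    {X : (V'.baseChange V.FunctionField).toAffine.Point}
    (h : {P : V.Point | specialize V V' P X = 0}.Infinite) : X = 0 := by
  cases X with
  | zero => rfl
  | some u w hX =>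
    exfalso
    by_cases hu : Transcendental k u
    · exact h (finite_fibre_specialize hX hu 0)
    · obtain ⟨P, hP⟩ := h.nonempty
      rw [Set.mem_setOf_eq, specialize_some_eq_zero_iff] at hP
      exact not_lt_of_ge (placeValuation_le_one_of_not_transcendental P hu) hP

/-- The places where an `L`-point is integral with prescribed `x`-residue behaviour: for
`u ≠ u'` in `L`, `v_P(u - u') = 1` off a finite set of places (among those where both are
integral). [folklore] -/
theorem finite_setOf_placeValuation_sub_lt_one [IsAlgClosed k] {u u' : V.FunctionField}
    (h : u ≠ u') : {P : V.Point | placeValuation V P (u - u') < 1}.Finite := by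
  refine (finite_support_ord (V := V) (sub_ne_zero.mpr h)).subset fun P hP ↦ ?_
  rw [Set.mem_setOf_eq, placeValuation_eq_exp_neg_ord P (sub_ne_zero.mpr h), ← WithZero.exp_zero,
    WithZero.exp_lt_exp] at hP
  rw [Function.mem_support]
  omega

/-- The places where a given `L`-point has a pole form a finite set. [folklore] -/
theorem finite_setOf_one_lt_placeValuation [IsAlgClosed k] {u w : V.FunctionField}
    (hX : (V'.baseChange V.FunctionField).toAffine.Nonsingular u w) :
    {P : V.Point | 1 < placeValuation V P u}.Finite := by
  by_cases hu : Transcendental k u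
  · refine (finite_fibre_specialize hX hu 0).subset fun P hP ↦ ?_
    rw [Set.mem_setOf_eq, specialize_some_eq_zero_iff]
    exact hP
  · convert Set.finite_empty
    ext P
    simp only [Set.mem_setOf_eq, Set.mem_empty_iff_false, iff_false, not_lt]
    exact placeValuation_le_one_of_not_transcendental P hu

/-- The places where a non-constant `L`-point is integral with `2`-torsion specialisation form
a finite set. [folklore] -/
theorem finite_setOf_two_nsmul_specialize_eq_zero [IsAlgClosed k] {u w : V.FunctionField}
    (hX : (V'.baseChange V.FunctionField).toAffine.Nonsingular u w) (hu : Transcendental k u) :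
    {P : V.Point | placeValuation V P u ≤ 1 ∧ 2 • specialize V V' P (.some u w hX) = 0}.Finite := by
  refine ((finite_setOf_two_nsmul_eq (V' := V') 0).biUnion (t := fun T ↦
    {P | specialize V V' P (.some u w hX) = T}) fun T _ ↦ finite_fibre_specialize hX hu T).subset ?_
  intro P hP
  simp only [Set.mem_iUnion, Set.mem_setOf_eq, exists_prop]
  exact ⟨_, hP.2, rfl⟩

/-- **An `L`-point is determined by its specialisations at infinitely many places**: if
`X(P) = Y(P)` for infinitely many `P` then `X = Y`. (Distinct `x`-coordinates have distinct
residues off a finite set; equal `x`-coordinates and opposite `y` force `2X(P) = O` infinitely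
often, impossible for non-constant `X` and meaning `X = -X = Y` for constant `X`.) Silverman,
*AEC*, II.2.1 with I.§3 (a rational map is determined by its values). [folklore] -/
theorem eq_of_infinite_setOf_specialize_eq [IsAlgClosed k]
    {A B : (V'.baseChange V.FunctionField).toAffine.Point}
    (h : {P : V.Point | specialize V V' P A = specialize V V' P B}.Infinite) : A = B := by
  cases A with
  | zero =>
    symm
    refine eq_zero_of_infinite_setOf_specialize_eq_zero (h.mono fun P hP ↦ ?_)
    rw [Set.mem_setOf_eq] at hP ⊢
    exact hP.symm
  | some uX wX hX =>
    cases B with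
    | zero => exact eq_zero_of_infinite_setOf_specialize_eq_zero h
    | some uY wY hY =>
      by_cases hux : uX = uY
      · subst hux
        rcases Affine.Y_eq_of_X_eq hX.left hY.left rfl with hw | hw
        · subst hw; rfl
        · -- `B = -A`
          by_cases hu : Transcendental k uX
          · -- `2 A(P) = O` on the set: finitely many places
            exfalso
            refine h (((finite_setOf_two_nsmul_specialize_eq_zero hX hu).union
              (finite_setOf_one_lt_placeValuation hX)).subset fun P hP ↦ ?_)
            rw [Set.mem_setOf_eq] at hP
            by_cases hi : placeValuation V P uX ≤ 1
            · left
              refine ⟨hi, ?_⟩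
              have hYX : (Affine.Point.some uX wY hY :
                  (V'.baseChange V.FunctionField).toAffine.Point) =
                    -Affine.Point.some uX wX hX := by
                rw [Affine.Point.neg_some, Affine.Point.some.injEq]
                exact ⟨rfl, by rw [hw, Affine.negY_negY]⟩
              rw [hYX, specialize_neg] at hP
              rw [two_nsmul, add_eq_zero_iff_eq_neg]
              exact hP
            · right
              exact not_le.mp hi
          · -- constant `A = (a, β)`, `B = (a, -β - a₁a - a₃)` with equal residues: `A = B`
            obtain ⟨a, rfl⟩ := exists_algebraMap_eq_of_isAlgebraic' (F := V.FunctionField)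
              (not_not.mp hu)
            obtain ⟨P, hP⟩ := h.nonempty
            rw [Set.mem_setOf_eq] at hP
            have hi := placeValuation_algebraMap_le_one (V := V) P a
            rw [specialize_some_of_le_one P hX hi, specialize_some_of_le_one P hY hi,
              Affine.Point.some.injEq] at hP
            obtain ⟨b, hb⟩ := WeierstrassCurve.exists_equation (V := V') a
            have hbL : (V'.baseChange V.FunctionField).toAffine.Equation
                (algebraMap k V.FunctionField a) (algebraMap k V.FunctionField b) :=
              (Affine.map_equation V' (FaithfulSMul.algebraMap_injective k V.FunctionField)
                a b).mpr hb
            obtain ⟨β, hβ⟩ : ∃ β : k, wX = algebraMap k V.FunctionField β := by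
              rcases Affine.Y_eq_of_X_eq hX.left hbL rfl with h1 | h1
              · exact ⟨b, h1⟩
              · exact ⟨V'.negY a b, by rw [h1, baseChange_negY_algebraMap]⟩
            subst hβ
            have hw' : wY = (V'.baseChange V.FunctionField).toAffine.negY
                (algebraMap k V.FunctionField a) (algebraMap k V.FunctionField β) := by
              rw [hw, Affine.negY_negY]
            rw [baseChange_negY_algebraMap] at hw'
            subst hw'
            rw [placeRes_algebraMap, placeRes_algebraMap, placeRes_algebraMap] at hP
            rw [Affine.Point.some.injEq]
            exact ⟨rfl, congrArg (algebraMap k V.FunctionField) hP.2⟩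
      · -- distinct `x`-coordinates: distinct residues off a finite set
        exfalso
        refine h (((finite_setOf_placeValuation_sub_lt_one (V := V) hux).union
          ((finite_setOf_one_lt_placeValuation hX).union
            (finite_setOf_one_lt_placeValuation hY))).subset fun P hP ↦ ?_)
        rw [Set.mem_setOf_eq] at hP
        by_cases hiX : placeValuation V P uX ≤ 1
        · by_cases hiY : placeValuation V P uY ≤ 1
          · left
            rw [Set.mem_setOf_eq]
            by_contra hv
            have hv1 : placeValuation V P (uX - uY) = 1 :=
              le_antisymm (Valuation.map_sub_le _ hiX hiY) (not_lt.mp hv)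
            have hres : placeRes V P (uX - uY) ≠ 0 := (placeValuation_eq_one_iff P hv1.le).mp hv1
            rw [specialize_some_of_le_one P hX hiX, specialize_some_of_le_one P hY hiY,
              Affine.Point.some.injEq] at hP
            rw [placeRes_sub P hiX hiY, hP.1, sub_self] at hres
            exact hres rfl
          · right; right; exact not_le.mp hiY
        · right; left; exact not_le.mp hiX

/-! ## Specialisation is additive at all but finitely many places -/

/-- For affine `L`-points with distinct `x`-coordinates, `(A + B)(P) = A(P) + B(P)` off a finite
set of places. Silverman, *AEC*, VII.2.1. [folklore] -/
theorem finite_setOf_specialize_add_ne [IsAlgClosed k] {uA wA uB wB : V.FunctionField}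
    (hA : (V'.baseChange V.FunctionField).toAffine.Nonsingular uA wA)
    (hB : (V'.baseChange V.FunctionField).toAffine.Nonsingular uB wB) (hne : uA ≠ uB) :
    {P : V.Point | specialize V V' P (.some uA wA hA + .some uB wB hB) ≠
      specialize V V' P (.some uA wA hA) + specialize V V' P (.some uB wB hB)}.Finite := by
  refine ((finite_setOf_placeValuation_sub_lt_one (V := V) hne).union
    ((finite_setOf_one_lt_placeValuation hA).union (finite_setOf_one_lt_placeValuation hB))).subset
    fun P hP ↦ ?_
  rw [Set.mem_setOf_eq] at hP
  by_cases hiA : placeValuation V P uA ≤ 1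
  · by_cases hiB : placeValuation V P uB ≤ 1
    · left
      rw [Set.mem_setOf_eq]
      by_contra hv
      exact hP (specialize_add_of_sub_eq_one P hA hB hiA hiB
        (le_antisymm (Valuation.map_sub_le _ hiA hiB) (not_lt.mp hv)))
    · right; right; exact not_le.mp hiB
  · right; left; exact not_le.mp hiA

omit [V'.IsElliptic] in
/-- **Residue of the tangent slope**: for an integral point `(u, w)` whose reduction `(α, β)` is
not `2`-torsion, the slope `(3u² + 2a₂u + a₄ - a₁w)/(w - (-w - a₁u - a₃))` of the tangent is
integral with residue the tangent slope at `(α, β)`. [folklore] -/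
theorem placeValuation_slope_self_le_one_and_placeRes (P : V.Point) {u w : V.FunctionField}
    (hu : placeValuation V P u ≤ 1) (hw : placeValuation V P w ≤ 1)
    (h2 : placeRes V P w ≠ V'.negY (placeRes V P u) (placeRes V P w)) :
    placeValuation V P ((V'.baseChange V.FunctionField).toAffine.slope u u w w) ≤ 1 ∧
      placeRes V P ((V'.baseChange V.FunctionField).toAffine.slope u u w w) =
        V'.slope (placeRes V P u) (placeRes V P u) (placeRes V P w) (placeRes V P w) := by
  obtain ⟨ha₁, ha₂, ha₃, ha₄, -⟩ := placeValuation_baseChange_a_le_one (V' := V') P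
  -- the denominator `w - negY u w`
  have hD : placeValuation V P (w - (V'.baseChange V.FunctionField).toAffine.negY u w) ≤ 1 :=
    Valuation.map_sub_le _ hw (placeValuation_negY_le_one P hu hw)
  have hDres : placeRes V P (w - (V'.baseChange V.FunctionField).toAffine.negY u w) =
      placeRes V P w - V'.negY (placeRes V P u) (placeRes V P w) := by
    have t1 : placeValuation V P (-w) ≤ 1 := by rwa [Valuation.map_neg]
    have t2 : placeValuation V P ((V'.baseChange V.FunctionField).toAffine.a₁ * u) ≤ 1 := by
      rw [map_mul]; exact mul_le_one' ha₁ hu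
    rw [placeRes_sub P hw (placeValuation_negY_le_one P hu hw), Affine.negY, Affine.negY,
      placeRes_sub P (Valuation.map_sub_le _ t1 t2) ha₃, placeRes_sub P t1 t2, placeRes_neg P hw,
      placeRes_mul P ha₁ hu, baseChange_a₁, baseChange_a₃, placeRes_algebraMap, placeRes_algebraMap]
  have hDne : placeRes V P (w - (V'.baseChange V.FunctionField).toAffine.negY u w) ≠ 0 := by
    rw [hDres]; exact sub_ne_zero.mpr h2
  have hwne : w ≠ (V'.baseChange V.FunctionField).toAffine.negY u w := by
    intro h
    rw [← sub_eq_zero] at h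
    rw [h, ← (algebraMap k V.FunctionField).map_zero, placeRes_algebraMap] at hDne
    exact hDne rfl
  have hD1 := placeValuation_eq_one_of_placeRes_ne_zero P hD hDne
  have hDinv : placeValuation V P
      (w - (V'.baseChange V.FunctionField).toAffine.negY u w)⁻¹ ≤ 1 := by
    rw [map_inv₀, hD1, inv_one]
  -- the numerator
  have h2u : placeValuation V P (2 : V.FunctionField) ≤ 1 := by
    exact_mod_cast Valuation.natCast_le_one (placeValuation V P) 2
  have h3u : placeValuation V P (3 : V.FunctionField) ≤ 1 := by
    exact_mod_cast Valuation.natCast_le_one (placeValuation V P) 3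
  have t3 : placeValuation V P (3 * u ^ 2) ≤ 1 := by
    rw [map_mul, map_pow]
    exact mul_le_one' h3u (pow_le_one₀ zero_le hu)
  have t4 : placeValuation V P (2 * (V'.baseChange V.FunctionField).toAffine.a₂ * u) ≤ 1 := by
    rw [map_mul, map_mul]
    exact mul_le_one' (mul_le_one' h2u ha₂) hu
  have t34 : placeValuation V P (3 * u ^ 2 + 2 * (V'.baseChange V.FunctionField).toAffine.a₂ * u)
      ≤ 1 := (Valuation.map_add _ _ _).trans (max_le t3 t4)
  have t345 : placeValuation V P (3 * u ^ 2 + 2 * (V'.baseChange V.FunctionField).toAffine.a₂ * u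
      + (V'.baseChange V.FunctionField).toAffine.a₄) ≤ 1 :=
    (Valuation.map_add _ _ _).trans (max_le t34 ha₄)
  have t6 : placeValuation V P ((V'.baseChange V.FunctionField).toAffine.a₁ * w) ≤ 1 := by
    rw [map_mul]; exact mul_le_one' ha₁ hw
  have hN : placeValuation V P (3 * u ^ 2 + 2 * (V'.baseChange V.FunctionField).toAffine.a₂ * u
      + (V'.baseChange V.FunctionField).toAffine.a₄ -
        (V'.baseChange V.FunctionField).toAffine.a₁ * w) ≤ 1 := Valuation.map_sub_le _ t345 t6
  have hu2 : placeValuation V P (u ^ 2) ≤ 1 := by rw [map_pow]; exact pow_le_one₀ zero_le hu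
  have h2a : placeValuation V P (2 * (V'.baseChange V.FunctionField).toAffine.a₂) ≤ 1 := by
    rw [map_mul]; exact mul_le_one' h2u ha₂
  rw [Affine.slope_of_Y_ne rfl hwne, Affine.slope_of_Y_ne rfl h2, div_eq_mul_inv, div_eq_mul_inv]
  refine ⟨by rw [map_mul]; exact mul_le_one' hN hDinv, ?_⟩
  rw [placeRes_mul P hN hDinv, placeRes_inv P hD hDne, hDres, placeRes_sub P t345 t6,
    placeRes_add P t34 ha₄, placeRes_add P t3 t4, placeRes_mul P h3u hu2, pow_two,
    placeRes_mul P hu hu, placeRes_mul P h2a hu, placeRes_mul P h2u ha₂, placeRes_mul P ha₁ hw,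
    baseChange_a₁, baseChange_a₂, baseChange_a₄, placeRes_algebraMap, placeRes_algebraMap,
    placeRes_algebraMap,
    show placeRes V P (2 : V.FunctionField) = 2 by
      rw [← map_ofNat (algebraMap k V.FunctionField) 2, placeRes_algebraMap],
    show placeRes V P (3 : V.FunctionField) = 3 by
      rw [← map_ofNat (algebraMap k V.FunctionField) 3, placeRes_algebraMap]]
  ring

/-- **Doubling specialises to doubling** off a finite set of places: for a non-constant affine
`L`-point `X`, `(X + X)(P) = X(P) + X(P)` for all but finitely many `P` (those where `X` is
integral with `X(P) ∉ V'[2]`: the tangent slope specialises to the tangent slope).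
Silverman, *AEC*, VII.2.1. [folklore] -/
theorem finite_setOf_specialize_add_self_ne [IsAlgClosed k] {u w : V.FunctionField}
    (hX : (V'.baseChange V.FunctionField).toAffine.Nonsingular u w) (hut : Transcendental k u) :
    {P : V.Point | specialize V V' P (.some u w hX + .some u w hX) ≠
      specialize V V' P (.some u w hX) + specialize V V' P (.some u w hX)}.Finite := by
  refine ((finite_setOf_two_nsmul_specialize_eq_zero hX hut).union
    (finite_setOf_one_lt_placeValuation hX)).subset fun P hP ↦ ?_
  rw [Set.mem_setOf_eq] at hP
  by_cases hu : placeValuation V P u ≤ 1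
  · left
    refine ⟨hu, ?_⟩
    by_contra h2
    have hw := placeValuation_y_le_one hX.left hu
    rw [specialize_some_of_le_one P hX hu, two_nsmul_some_eq_zero_iff] at h2
    obtain ⟨hsl, hslr⟩ := placeValuation_slope_self_le_one_and_placeRes (V' := V') P hu hw h2
    have hwne : w ≠ (V'.baseChange V.FunctionField).toAffine.negY u w := by
      intro h
      apply h2
      conv_lhs => rw [h]
      obtain ⟨ha₁, -, ha₃, -, -⟩ := placeValuation_baseChange_a_le_one (V' := V') P
      have t1 : placeValuation V P (-w) ≤ 1 := by rwa [Valuation.map_neg]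
      have t2 : placeValuation V P ((V'.baseChange V.FunctionField).toAffine.a₁ * u) ≤ 1 := by
        rw [map_mul]; exact mul_le_one' ha₁ hu
      rw [Affine.negY, Affine.negY, placeRes_sub P (Valuation.map_sub_le _ t1 t2) ha₃,
        placeRes_sub P t1 t2, placeRes_neg P hw, placeRes_mul P ha₁ hu, baseChange_a₁,
        baseChange_a₃, placeRes_algebraMap, placeRes_algebraMap]
    obtain ⟨hX3, hX3r⟩ := placeValuation_addX_le_one_and_placeRes (V' := V') P hu hu hsl
    obtain ⟨hY3, hY3r⟩ := placeValuation_addY_le_one_and_placeRes (V' := V') P hu hu hw hsl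
    apply hP
    rw [Affine.Point.add_self_of_Y_ne hwne, specialize_some_of_le_one P _ hX3,
      specialize_some_of_le_one P hX hu, Affine.Point.add_self_of_Y_ne h2, Affine.Point.some.injEq]
    exact ⟨by rw [hX3r, hslr], by rw [hY3r, hslr]⟩
  · right
    exact not_le.mp hu

end Unique

end Literature.NumberTheory.EllipticCurves.WeierstrassFunctionField

namespace WeierstrassCurve

open geomPoints Literature.NumberTheory.EllipticCurves.WeierstrassFunctionField

variable {K : Type u} [Field K] {W W' : WeierstrassCurve K}

section Bridge

/-- A polynomial `q(x, y) ∈ K̄[E] ⊆ K̄(E)` is integral at an affine point `(a, b)` with residue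
`q(a, b)`. [folklore] -/
theorem placeValuation_evalGeneric_le_one_and_placeRes [W.IsElliptic] {a b : AlgebraicClosure K}
    (hab : (W.baseChange (AlgebraicClosure K)).toAffine.Nonsingular a b)
    (q : MvPolynomial (Fin 2) (AlgebraicClosure K)) :
    placeValuation (W.baseChange (AlgebraicClosure K)).toAffine (.some a b hab) (W.evalGeneric q)
        ≤ 1 ∧
      placeRes (W.baseChange (AlgebraicClosure K)).toAffine (.some a b hab) (W.evalGeneric q) =
        MvPolynomial.eval ![a, b] q := by
  rw [evalGeneric_apply]
  refine ⟨placeValuation_some_algebraMap_le_one hab _, ?_⟩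
  rw [placeRes_some_algebraMap hab, pointEval_mk, eval_eq_evalEval_equivMvPolynomial_symm]

/-- **From values to places**: if `z ∈ K̄(E)` has value `c` at the affine point `P` (in the
sense of `HasValueAt`: `z = g/h` with `h(P) ≠ 0`, `g(P) = c h(P)`), then `z` is integral at the
place `P` with residue `c`. Silverman, *AEC*, II.§1 (`K̄[C]_P` is the valuation ring of
`ord_P`). [folklore] -/
theorem HasValueAt.placeValuation_le_one_and_placeRes [W.IsElliptic] {z : W.geomFunctionField}
    {a b : AlgebraicClosure K} (hab : (W.baseChange (AlgebraicClosure K)).toAffine.Nonsingular a b)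
    {c : AlgebraicClosure K} (h : W.HasValueAt z (.some a b hab) c) :
    placeValuation (W.baseChange (AlgebraicClosure K)).toAffine (.some a b hab) z ≤ 1 ∧
      placeRes (W.baseChange (AlgebraicClosure K)).toAffine (.some a b hab) z = c := by
  obtain ⟨g, h, hh, hz, hg⟩ := h
  rw [xy_some] at hh hg
  obtain ⟨hvh, hrh⟩ := placeValuation_evalGeneric_le_one_and_placeRes (W := W) hab h
  obtain ⟨hvg, hrg⟩ := placeValuation_evalGeneric_le_one_and_placeRes (W := W) hab g
  have hh1 : placeValuation (W.baseChange (AlgebraicClosure K)).toAffine (.some a b hab)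
      (W.evalGeneric h) = 1 :=
    placeValuation_eq_one_of_placeRes_ne_zero _ hvh (by rwa [hrh])
  have hh0 : W.evalGeneric h ≠ 0 := fun h0 ↦ by
    rw [h0, map_zero] at hh1; exact zero_ne_one hh1
  have hzq : z = W.evalGeneric g * (W.evalGeneric h)⁻¹ := by
    rw [← div_eq_mul_inv, eq_div_iff hh0, hz]
  have hinv : placeValuation (W.baseChange (AlgebraicClosure K)).toAffine (.some a b hab)
      (W.evalGeneric h)⁻¹ ≤ 1 := by
    rw [map_inv₀, hh1, inv_one]
  rw [hzq]
  refine ⟨by rw [map_mul]; exact mul_le_one' hvg hinv, ?_⟩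
  rw [placeRes_mul _ hvg hinv, placeRes_inv _ hvh (by rwa [hrh]), hrg, hrh, hg,
    mul_inv_cancel_right₀ hh]

end Bridge

section GenericImage

variable [W.IsElliptic] [W'.IsElliptic]

omit [W.IsElliptic] [W'.IsElliptic] in
/-- The double base change `(E' ⊗ K̄) ⊗ K̄(E)` is `E' ⊗ K̄(E)`. [folklore] -/
theorem baseChange_baseChange_geomFunctionField :
    (W'.baseChange (AlgebraicClosure K)).baseChange W.geomFunctionField =
      W'.baseChange W.geomFunctionField :=
  map_baseChange W' (Algebra.ofId (AlgebraicClosure K) W.geomFunctionField)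

namespace Isogeny

/-- `(φ^* x', φ^* y')` is a nonsingular point of `E' ⊗ K̄` over `L = K̄(E)`. [folklore] -/
theorem nonsingular_pullback' (φ : Isogeny W W') :
    ((W'.baseChange (AlgebraicClosure K)).toAffine.baseChange
      W.geomFunctionField).toAffine.Nonsingular φ.pullbackX φ.pullbackY := by
  have := φ.nonsingular_pullback
  rwa [← baseChange_baseChange_geomFunctionField] at this

/-- **The generic image `φ(x, y) ∈ E'(K̄(E))` of an isogeny as an `L`-point of `E' ⊗ K̄` over
`L = K̄(E)`** (the point type of `LPointPolarDegree`, on which `specialize`, `polarDeg` act).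
Silverman, *AEC*, proof of Thm. III.6.2(c). [folklore] -/
def genericLPoint (φ : Isogeny W W') :
    ((W'.baseChange (AlgebraicClosure K)).toAffine.baseChange W.geomFunctionField).toAffine.Point :=
  .some φ.pullbackX φ.pullbackY φ.nonsingular_pullback'

/-- The generic image has transcendental (non-constant) `x`-coordinate. [folklore] -/
theorem genericLPoint_eq (φ : Isogeny W W') :
    φ.genericLPoint = .some φ.pullbackX φ.pullbackY φ.nonsingular_pullback' := rfl

/-- **The generic image specialises to the values of the isogeny**: `φ(x, y)(P) = φ(P)` for all
`P` outside the (finite) exceptional set of the rational representation of `φ`.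
Silverman, *AEC*, II.2.1, III.§4. [folklore] -/
theorem specialize_genericLPoint (φ : Isogeny W W') {P : W.geomPoints}
    (hP : AgreesWithRationalMapAt W W' φ.rationalRep.P₁ φ.rationalRep.Q₁ φ.rationalRep.P₂
      φ.rationalRep.Q₂ φ P) :
    specialize (W.baseChange (AlgebraicClosure K)).toAffine
      (W'.baseChange (AlgebraicClosure K)).toAffine P φ.genericLPoint = φ P := by
  obtain ⟨hP0, hQ₁, hQ₂, h', e⟩ := agreesWithRationalMapAt_iff.mp hP
  have hx := (hasValueAt_div (W := W) hP0 (g := φ.rationalRep.P₁) hQ₁)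
  have hy := (hasValueAt_div (W := W) hP0 (g := φ.rationalRep.P₂) hQ₂)
  obtain ⟨a, b, hab, rfl⟩ := geomPoints.exists_eq_some hP0
  obtain ⟨hvx, hrx⟩ := hx.placeValuation_le_one_and_placeRes hab
  obtain ⟨hvy, hry⟩ := hy.placeValuation_le_one_and_placeRes hab
  have hX : φ.pullbackX = W.evalGeneric φ.rationalRep.P₁ / W.evalGeneric φ.rationalRep.Q₁ := rfl
  have hY : φ.pullbackY = W.evalGeneric φ.rationalRep.P₂ / W.evalGeneric φ.rationalRep.Q₂ := rfl
  rw [genericLPoint_eq, specialize_some_of_le_one _ _ (by rw [hX]; exact hvx), e,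
    Affine.Point.some.injEq]
  exact ⟨by rw [hX, hrx], by rw [hY, hry]⟩

/-- The exceptional set is finite: `φ(x, y)(P) = φ(P)` off a finite set. [folklore] -/
theorem finite_setOf_specialize_genericLPoint_ne (φ : Isogeny W W') :
    {P : (W.baseChange (AlgebraicClosure K)).toAffine.Point |
      specialize (W.baseChange (AlgebraicClosure K)).toAffine
        (W'.baseChange (AlgebraicClosure K)).toAffine P φ.genericLPoint ≠ φ P}.Finite :=
  φ.rationalRep.finite.subset fun _ hP hA ↦ hP (φ.specialize_genericLPoint hA)

/-- `x(φ(x, y)) = φ^* x'` is transcendental over `K̄`. [folklore] -/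
theorem genericLPoint_nonconst (φ : Isogeny W W') :
    φ.genericLPoint = 0 ∨ ∃ u w h, φ.genericLPoint = .some u w h ∧
      Transcendental (AlgebraicClosure K) u :=
  Or.inr ⟨_, _, _, rfl, φ.transcendental_pullbackX⟩

/-- **Generic images are additive**: if `χ = φ + ψ` on points then `χ(x, y) = φ(x, y) + ψ(x, y)`
in `E'(K̄(E))` (both sides specialise to `φ(P) + ψ(P)` at all but finitely many `P`, and an
`L`-point is determined by infinitely many specialisations). Silverman, *AEC*, III.3.6,
III.§4 (`Hom(E₁, E₂)` is a group). [folklore] -/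
theorem genericLPoint_eq_add {χ φ ψ : Isogeny W W'} (h : ∀ P, χ P = φ P + ψ P) :
    χ.genericLPoint = φ.genericLPoint + ψ.genericLPoint := by
  haveI : Infinite (W.baseChange (AlgebraicClosure K)).toAffine.Point :=
    WeierstrassCurve.infinite_point (V := W.baseChange _)
  refine eq_of_infinite_setOf_specialize_eq ?_
  -- additivity of specialisation for the pair `(φ(x,y), ψ(x,y))` off a finite set
  have hadd : {P : (W.baseChange (AlgebraicClosure K)).toAffine.Point |
      specialize (W.baseChange (AlgebraicClosure K)).toAffine
      (W'.baseChange (AlgebraicClosure K)).toAffine P (φ.genericLPoint + ψ.genericLPoint) ≠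
      specialize _ _ P φ.genericLPoint + specialize _ _ P ψ.genericLPoint}.Finite := by
    by_cases hx : φ.pullbackX = ψ.pullbackX
    · -- `ψ(x,y) = ± φ(x,y)`
      rcases Affine.Y_eq_of_X_eq φ.nonsingular_pullback'.left ψ.nonsingular_pullback'.left hx
        with hy | hy
      · have : ψ.genericLPoint = φ.genericLPoint := by
          rw [genericLPoint_eq, genericLPoint_eq, Affine.Point.some.injEq]; exact ⟨hx.symm, hy.symm⟩
        rw [this]
        exact finite_setOf_specialize_add_self_ne _ φ.transcendental_pullbackX
      · have : ψ.genericLPoint = -φ.genericLPoint := by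
          rw [genericLPoint_eq, genericLPoint_eq, Affine.Point.neg_some, Affine.Point.some.injEq]
          refine ⟨hx.symm, ?_⟩
          rw [hy, hx, Affine.negY_negY]
        rw [this, show φ.genericLPoint + -φ.genericLPoint = 0 from add_neg_cancel φ.genericLPoint]
        refine Set.finite_empty.subset fun P hP ↦ (hP ?_).elim
        rw [specialize_zero, specialize_neg]
        exact (add_neg_cancel (specialize _ _ P φ.genericLPoint)).symm
    · exact finite_setOf_specialize_add_ne _ _ hx
  refine ((hadd.union (χ.finite_setOf_specialize_genericLPoint_ne.union
    (φ.finite_setOf_specialize_genericLPoint_ne.union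
      ψ.finite_setOf_specialize_genericLPoint_ne))).infinite_compl).mono fun P hP ↦ ?_
  simp only [Set.mem_compl_iff, Set.mem_union, Set.mem_setOf_eq, not_or, not_not] at hP
  obtain ⟨h1, h2, h3, h4⟩ := hP
  rw [Set.mem_setOf_eq, h2, h1, h3, h4, h]
  rfl

/-- **Generic images are odd**: if `χ = -φ` on points then `χ(x, y) = -φ(x, y)`. [folklore] -/
theorem genericLPoint_eq_neg {χ φ : Isogeny W W'} (h : ∀ P, χ P = -φ P) :
    χ.genericLPoint = -φ.genericLPoint := by
  haveI : Infinite (W.baseChange (AlgebraicClosure K)).toAffine.Point :=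
    WeierstrassCurve.infinite_point (V := W.baseChange _)
  refine eq_of_infinite_setOf_specialize_eq ?_
  refine ((χ.finite_setOf_specialize_genericLPoint_ne.union
    φ.finite_setOf_specialize_genericLPoint_ne).infinite_compl).mono fun P hP ↦ ?_
  simp only [Set.mem_compl_iff, Set.mem_union, Set.mem_setOf_eq, not_or, not_not] at hP
  rw [Set.mem_setOf_eq, specialize_neg, hP.1, hP.2, h]
  rfl

end Isogeny

end GenericImage

section Degree

variable [W.IsElliptic] [W'.IsElliptic]

omit [W'.IsElliptic] in
/-- An isogeny is not the zero map (its kernel is finite, `E(K̄)` is infinite). [folklore] -/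
theorem Isogeny.toAddMonoidHom_ne_zero (φ : Isogeny W W') : φ.toAddMonoidHom ≠ 0 := by
  intro h0
  haveI : Infinite W.geomPoints := WeierstrassCurve.infinite_point (V := W.baseChange _)
  refine Set.infinite_univ (φ.finite_ker.subset fun P _ ↦ ?_)
  change φ.toAddMonoidHom P = 0
  rw [h0, AddMonoidHom.zero_apply]

/-- **The `L`-point of a homomorphism**: for `f ∈ Hom(E(K̄), E'(K̄))`, the generic image
`φ(x, y) ∈ E'(K̄(E))` of the isogeny `φ` with underlying map `f` (unique, `Isogeny.ext`), and `O`
if `f` underlies no isogeny (in particular for `f = 0`). Silverman, *AEC*, proof of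
Thm. III.6.2(c). [folklore] -/
def homLPoint (f : W.geomPoints →+ W'.geomPoints) :
    ((W'.baseChange (AlgebraicClosure K)).toAffine.baseChange W.geomFunctionField).toAffine.Point :=
  if h : ∃ φ : Isogeny W W', φ.toAddMonoidHom = f then h.choose.genericLPoint else 0

/-- The `L`-point of (the map of) an isogeny is its generic image. [folklore] -/
theorem homLPoint_toAddMonoidHom (φ : Isogeny W W') :
    homLPoint φ.toAddMonoidHom = φ.genericLPoint := by
  have h : ∃ ψ : Isogeny W W', ψ.toAddMonoidHom = φ.toAddMonoidHom := ⟨φ, rfl⟩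
  rw [homLPoint, dif_pos h]
  have : h.choose = φ := Isogeny.ext fun P ↦ by
    have := congrArg (fun g ↦ g P) h.choose_spec
    simpa using this
  rw [this]

/-- The `L`-point of the zero map is `O`. [folklore] -/
theorem homLPoint_zero : homLPoint (0 : W.geomPoints →+ W'.geomPoints) = 0 := by
  rw [homLPoint, dif_neg]
  rintro ⟨φ, hφ⟩
  exact φ.toAddMonoidHom_ne_zero hφ

/-- The `L`-point of a homomorphism is `O` or has non-constant `x`-coordinate. [folklore] -/
theorem homLPoint_nonconst (f : W.geomPoints →+ W'.geomPoints) :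
    homLPoint f = 0 ∨ ∃ u w h, homLPoint f = .some u w h ∧
      Transcendental (AlgebraicClosure K) u := by
  by_cases h : ∃ φ : Isogeny W W', φ.toAddMonoidHom = f
  · obtain ⟨φ, rfl⟩ := h
    rw [homLPoint_toAddMonoidHom]
    exact φ.genericLPoint_nonconst
  · left
    rw [homLPoint, dif_neg h]

/-- **`f ↦ f(x, y)` is additive on `Hom_K(E, E')`.** Silverman, *AEC*, III.3.6, III.§4.
[folklore] -/
theorem homLPoint_add {f g : W.geomPoints →+ W'.geomPoints} (hf : f ∈ homModule W W')
    (hg : g ∈ homModule W W') : homLPoint (f + g) = homLPoint f + homLPoint g := by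
  have hfg := Submodule.add_mem _ hf hg
  rcases ((mem_homModule_iff_holds W W') f).mp hf with rfl | ⟨φ, rfl⟩
  · rw [zero_add, homLPoint_zero]
    exact (zero_add (homLPoint g)).symm
  rcases ((mem_homModule_iff_holds W W') g).mp hg with rfl | ⟨ψ, rfl⟩
  · rw [add_zero, homLPoint_zero]
    exact (add_zero (homLPoint φ.toAddMonoidHom)).symm
  rw [homLPoint_toAddMonoidHom, homLPoint_toAddMonoidHom]
  rcases ((mem_homModule_iff_holds W W') _).mp hfg with h0 | ⟨χ, hχ⟩
  · rw [h0, homLPoint_zero]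
    have hneg : ∀ P, ψ P = -φ P := fun P ↦ by
      have := congrArg (fun g ↦ g P) h0
      simp only [AddMonoidHom.add_apply, Isogeny.coe_toAddMonoidHom, AddMonoidHom.zero_apply]
        at this
      exact eq_neg_of_add_eq_zero_right this
    rw [Isogeny.genericLPoint_eq_neg hneg]
    exact (add_neg_cancel φ.genericLPoint).symm
  · rw [← hχ, homLPoint_toAddMonoidHom]
    refine Isogeny.genericLPoint_eq_add fun P ↦ ?_
    have := congrArg (fun g ↦ g P) hχ
    simpa using this

/-- **`f ↦ f(x, y)` is odd on `Hom_K(E, E')`.** [folklore] -/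
theorem homLPoint_neg {f : W.geomPoints →+ W'.geomPoints} (hf : f ∈ homModule W W') :
    homLPoint (-f) = -homLPoint f := by
  rcases ((mem_homModule_iff_holds W W') f).mp hf with rfl | ⟨φ, rfl⟩
  · rw [neg_zero, homLPoint_zero]
    exact (neg_zero (G := ((W'.baseChange (AlgebraicClosure K)).toAffine.baseChange
      W.geomFunctionField).toAffine.Point)).symm
  rcases ((mem_homModule_iff_holds W W') _).mp (Submodule.neg_mem _ hf) with h0 | ⟨χ, hχ⟩
  · exact absurd (neg_eq_zero.mp h0) φ.toAddMonoidHom_ne_zero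
  · rw [← hχ, homLPoint_toAddMonoidHom, homLPoint_toAddMonoidHom]
    refine Isogeny.genericLPoint_eq_neg fun P ↦ ?_
    have := congrArg (fun g ↦ g P) hχ
    simpa using this

/-- `f ↦ f(x, y)` respects subtraction on `Hom_K(E, E')`. [folklore] -/
theorem homLPoint_sub {f g : W.geomPoints →+ W'.geomPoints} (hf : f ∈ homModule W W')
    (hg : g ∈ homModule W W') : homLPoint (f - g) = homLPoint f - homLPoint g := by
  rw [sub_eq_add_neg f g, homLPoint_add hf (Submodule.neg_mem _ hg), homLPoint_neg hg]
  exact (sub_eq_add_neg (homLPoint f) (homLPoint g)).symm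

/-- **The polar degree on `Hom(E(K̄), E'(K̄))`**: `deg f := d(f(x, y))`, the polar degree
(`LPointPolarDegree.polarDeg`) of the `L`-point of `f`; for an isogeny `φ` this is
`Σ_{P ∈ φ⁻¹(O')} e_φ(P)`, which is `deg φ` by Silverman, *AEC*, Prop. II.2.6(a) (an
identification not proved or used here), and `deg 0 = 0`. [folklore] -/
def polarDegHom (f : W.geomPoints →+ W'.geomPoints) : ℤ :=
  polarDeg (W.baseChange (AlgebraicClosure K)).toAffine
    (W'.baseChange (AlgebraicClosure K)).toAffine (homLPoint f)

/-- **The parallelogram law for `deg` on `Hom_K(E, E')`** (Silverman, *AEC*, Cor. III.6.3),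
from `LPointParallelogram.polarDeg_parallelogram`. [folklore] -/
theorem polarDegHom_parallelogram {f g : W.geomPoints →+ W'.geomPoints} (hf : f ∈ homModule W W')
    (hg : g ∈ homModule W W') :
    polarDegHom (f + g) + polarDegHom (f - g) = 2 * polarDegHom f + 2 * polarDegHom g := by
  unfold polarDegHom
  rw [homLPoint_add hf hg, homLPoint_sub hf hg]
  exact_mod_cast polarDeg_parallelogram (homLPoint_nonconst f) (homLPoint_nonconst g)

/-- **`deg f > 0` for `f ∈ Hom_K(E, E') ∖ {0}`** (Silverman, *AEC*, Thm. II.2.4(a) in the form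
`deg φ ≥ 1`): the fibre of `φ(x, y)` over `φ(P₀)` contains `P₀` for generic `P₀`. [folklore] -/
theorem polarDegHom_pos {f : W.geomPoints →+ W'.geomPoints} (hf : f ∈ homModule W W')
    (h0 : f ≠ 0) : 0 < polarDegHom f := by
  rcases ((mem_homModule_iff_holds W W') f).mp hf with rfl | ⟨φ, rfl⟩
  · exact (h0 rfl).elim
  unfold polarDegHom
  rw [homLPoint_toAddMonoidHom, Isogeny.genericLPoint_eq,
    polarDeg_some_of_transcendental _ φ.transcendental_pullbackX]
  haveI : Infinite (W.baseChange (AlgebraicClosure K)).toAffine.Point :=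
    WeierstrassCurve.infinite_point (V := W.baseChange _)
  obtain ⟨P₀, hP₀⟩ := φ.finite_setOf_specialize_genericLPoint_ne.infinite_compl.nonempty
  rw [Set.mem_compl_iff, Set.mem_setOf_eq, not_not, Isogeny.genericLPoint_eq] at hP₀
  rw [fibreDegree_eq_fibreDegree_zero _ _ (φ P₀) |>.symm, fibreDegree_eq_sum]
  have hmem : P₀ ∈ (finite_fibre_specialize φ.nonsingular_pullback' φ.transcendental_pullbackX
      (φ P₀)).toFinset := by
    rw [Set.Finite.mem_toFinset, Set.mem_setOf_eq]
    exact hP₀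
  have := Finset.single_le_sum (fun P _ ↦ Nat.zero_le (ramificationIdx
    (W.baseChange (AlgebraicClosure K)).toAffine (W'.baseChange (AlgebraicClosure K)).toAffine P
      φ.nonsingular_pullback' φ.transcendental_pullbackX)) hmem
  have hpos := ramificationIdx_pos (V := (W.baseChange (AlgebraicClosure K)).toAffine)
    (V' := (W'.baseChange (AlgebraicClosure K)).toAffine) P₀ φ.nonsingular_pullback'
    φ.transcendental_pullbackX
  exact_mod_cast lt_of_lt_of_le hpos this

end Degree

section KernelTranslation

variable [W.IsElliptic]

/-- A function integral at an affine place `S` has a value at `S` in the sense of `HasValueAt`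
(write it as `n/d` with `n, d ∈ K̄[E]`, `d(S) ≠ 0`). [folklore] -/
theorem exists_hasValueAt_of_placeValuation_le_one {z : W.geomFunctionField} {S : W.geomPoints}
    (hS : S ≠ 0) (hz : placeValuation (W.baseChange (AlgebraicClosure K)).toAffine S z ≤ 1) :
    ∃ c, W.HasValueAt z S c := by
  obtain ⟨a, b, hab, rfl⟩ := geomPoints.exists_eq_some hS
  rw [placeValuation_some] at hz
  obtain ⟨n, d, hnd⟩ := (pointPrime hab.left).exists_primeCompl_mul_eq_of_integer z hz
  obtain ⟨n₂, hn₂⟩ := AdjoinRoot.mk_surjective n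
  obtain ⟨d₂, hd₂⟩ :=
    AdjoinRoot.mk_surjective (d : (W.baseChange (AlgebraicClosure K)).toAffine.CoordinateRing)
  have hg : W.evalGeneric (Polynomial.Bivariate.equivMvPolynomial (AlgebraicClosure K) n₂) =
      algebraMap _ W.geomFunctionField n := by
    rw [evalGeneric_apply, AlgEquiv.symm_apply_apply, ← hn₂]
  have hh : W.evalGeneric (Polynomial.Bivariate.equivMvPolynomial (AlgebraicClosure K) d₂) =
      algebraMap _ W.geomFunctionField
        (d : (W.baseChange (AlgebraicClosure K)).toAffine.CoordinateRing) := by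
    rw [evalGeneric_apply, AlgEquiv.symm_apply_apply, ← hd₂]
  have hhP : MvPolynomial.eval (xy (Affine.Point.some a b hab : W.geomPoints))
      (Polynomial.Bivariate.equivMvPolynomial (AlgebraicClosure K) d₂) ≠ 0 := by
    rw [xy_some, eval_eq_evalEval_equivMvPolynomial_symm, AlgEquiv.symm_apply_apply,
      Ne, ← mk_mem_pointIdeal_iff hab.left]
    have : (d : (W.baseChange (AlgebraicClosure K)).toAffine.CoordinateRing) ∉
        pointIdeal (W.baseChange (AlgebraicClosure K)).toAffine a b := d.2
    rwa [← hd₂] at this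
  exact ⟨_, hasValueAt_of_mul_eq (g := Polynomial.Bivariate.equivMvPolynomial _ n₂) hhP
    (by rw [hh, hg]; exact hnd)⟩

/-- One-sided comparison: `v_P ∘ τ_T^* = v_{P+T} ^ e` for some `e ≥ 1` (`P, P + T` affine,
`P ≠ T`), from the transport of values `(τ_T^* z)(P) = z(P + T)`. [folklore] -/
theorem exists_placeValuation_transAlgHom_eq_pow {P T : W.geomPoints} (hP : P ≠ 0) (hPT : P ≠ T)
    (hPT' : P + T ≠ 0) : ∃ e : ℕ, 0 < e ∧ ∀ z,
      placeValuation (W.baseChange (AlgebraicClosure K)).toAffine P (W.transAlgHom T z) =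
        placeValuation (W.baseChange (AlgebraicClosure K)).toAffine (P + T) z ^ e := by
  obtain ⟨a, b, hab, hPTe⟩ := geomPoints.exists_eq_some hPT'
  obtain ⟨a', b', hab', hPe⟩ := geomPoints.exists_eq_some hP
  refine Valuation.exists_eq_pow_of_le_one_imp
    ((placeValuation (W.baseChange (AlgebraicClosure K)).toAffine P).comap
      (W.transAlgHom T).toRingHom) _ ?_ ?_ ?_
  · intro t ht
    obtain ⟨c, hc⟩ := exists_hasValueAt_of_placeValuation_le_one hPT' ht
    have h1 := hc.transAlgHom hP hPT hPT'
    rw [hPe] at h1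
    have := (HasValueAt.placeValuation_le_one_and_placeRes hab' h1).1
    rw [← hPe] at this
    exact this
  · intro t ht
    obtain ⟨c, hc⟩ := exists_hasValueAt_of_placeValuation_le_one hPT' ht.le
    have h1 := hc.transAlgHom hP hPT hPT'
    rw [hPTe] at hc ht
    have hc0 : c = 0 := by
      rw [← (HasValueAt.placeValuation_le_one_and_placeRes hab hc).2]
      exact (placeRes_eq_zero_iff _ ht.le).mpr ht
    rw [hPe] at h1
    obtain ⟨hv, hr⟩ := HasValueAt.placeValuation_le_one_and_placeRes hab' h1
    rw [hc0] at hr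
    have := (placeRes_eq_zero_iff _ hv).mp hr
    rw [← hPe] at this
    exact this
  · rw [hPTe, placeValuation_some]
    exact (pointPrime hab.left).valuation_exists_uniformizer _

/-- **Translations transport the valuations: `v_P ∘ τ_T^* = v_{P+T}`** (for `P, P + T` affine,
`P ≠ T`, `P + T ≠ -T`; from the one-sided comparison in both directions and a uniformizer).
The tree's `WeilPairingDivisors.placeValuation_transAlgHom` (not imported here, to keep the
import closure small) removes the genericity hypotheses. Silverman, *AEC*, II.§2
(`ord_P(φ^* f) = e_φ(P) ord_{φP}(f)` with `e = 1` for the automorphism `τ_T`). [folklore] -/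
theorem placeValuation_transAlgHom_of_ne {P T : W.geomPoints} (hP : P ≠ 0) (hPT : P ≠ T)
    (hPT' : P + T ≠ 0) (hPT2 : P + T ≠ -T) (z : W.geomFunctionField) :
    placeValuation (W.baseChange (AlgebraicClosure K)).toAffine P (W.transAlgHom T z) =
      placeValuation (W.baseChange (AlgebraicClosure K)).toAffine (P + T) z := by
  obtain ⟨e₁, he₁, h₁⟩ := exists_placeValuation_transAlgHom_eq_pow hP hPT hPT'
  have hback : P + T + -T = P := add_neg_cancel_right P T
  obtain ⟨e₂, he₂, h₂⟩ := exists_placeValuation_transAlgHom_eq_pow (W := W) (P := P + T)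
    (T := -T) hPT' hPT2 (by rw [hback]; exact hP)
  rw [hback] at h₂
  -- `v_P = v_P ^ (e₁ e₂)`, so `e₁ = e₂ = 1`
  obtain ⟨a', b', hab', hPe⟩ := geomPoints.exists_eq_some hP
  obtain ⟨π, hπ⟩ : ∃ π, placeValuation (W.baseChange (AlgebraicClosure K)).toAffine P π =
      WithZero.exp (-1) := by
    rw [hPe, placeValuation_some]
    exact (pointPrime hab'.left).valuation_exists_uniformizer _
  have key : placeValuation (W.baseChange (AlgebraicClosure K)).toAffine P π =
      placeValuation (W.baseChange (AlgebraicClosure K)).toAffine P π ^ (e₁ * e₂) := by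
    conv_lhs => rw [show π = W.transAlgHom T (W.transAlgHom (-T) π) by
      rw [← AlgHom.comp_apply, transAlgHom_comp_neg]; rfl]
    rw [h₁, h₂, ← pow_mul, mul_comm]
  rw [hπ, ← WithZero.exp_nsmul, WithZero.exp_inj] at key
  have h11 : e₁ * e₂ = 1 := by
    rw [nsmul_eq_mul, mul_neg, mul_one] at key
    exact_mod_cast (neg_inj.mp key).symm
  rw [h₁, Nat.eq_one_of_mul_eq_one_right h11, pow_one]

variable [W'.IsElliptic]

/-- **Ramification is invariant under kernel translations**: for `T ∈ ker φ` and generic `P`,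
`e_{φ(x,y)}(P + T) = e_{φ(x,y)}(P)` (`τ_T^*` fixes `φ^* K̄(E')` and transports `v_P` to
`v_{P+T}`, while `φ(P + T) = φ(P)`). Silverman, *AEC*, III.4.10 (proof of (a)/(b)). [folklore] -/
theorem Isogeny.ramificationIdx_add_eq (φ : Isogeny W W') {P T : W.geomPoints} (hT : φ T = 0)
    (hP : P ≠ 0) (hPT : P ≠ T) (hPT' : P + T ≠ 0) (hPT2 : P + T ≠ -T) (hφP : φ P ≠ 0)
    (hPB : AgreesWithRationalMapAt W W' φ.rationalRep.P₁ φ.rationalRep.Q₁ φ.rationalRep.P₂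
      φ.rationalRep.Q₂ φ P)
    (hPTB : AgreesWithRationalMapAt W W' φ.rationalRep.P₁ φ.rationalRep.Q₁ φ.rationalRep.P₂
      φ.rationalRep.Q₂ φ (P + T)) :
    ramificationIdx (W.baseChange (AlgebraicClosure K)).toAffine
        (W'.baseChange (AlgebraicClosure K)).toAffine (P + T) φ.nonsingular_pullback'
        φ.transcendental_pullbackX =
      ramificationIdx (W.baseChange (AlgebraicClosure K)).toAffine
        (W'.baseChange (AlgebraicClosure K)).toAffine P φ.nonsingular_pullback'
        φ.transcendental_pullbackX := by
  set Φ := pointPullback (V := (W.baseChange (AlgebraicClosure K)).toAffine)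
    (V' := (W'.baseChange (AlgebraicClosure K)).toAffine) φ.nonsingular_pullback'.left
    φ.transcendental_pullbackX with hΦ
  have hfix : (W.transAlgHom T).comp Φ = Φ := by
    refine algHom_ext_xy ?_ ?_
    · rw [AlgHom.comp_apply, hΦ, pointPullback_xF]
      exact φ.transAlgHom_pullbackX hT
    · rw [AlgHom.comp_apply, hΦ, pointPullback_yF]
      exact φ.transAlgHom_pullbackY hT
  have hφPT : φ (P + T) = φ P := by rw [map_add, hT, add_zero]
  have hsP := φ.specialize_genericLPoint hPB
  have hsPT := φ.specialize_genericLPoint hPTB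
  rw [Isogeny.genericLPoint_eq] at hsP hsPT
  have key : ∀ t, placeValuation (W'.baseChange (AlgebraicClosure K)).toAffine (φ P) t ^
      ramificationIdx _ _ P φ.nonsingular_pullback' φ.transcendental_pullbackX =
      placeValuation (W'.baseChange (AlgebraicClosure K)).toAffine (φ P) t ^
      ramificationIdx _ _ (P + T) φ.nonsingular_pullback' φ.transcendental_pullbackX := by
    intro t
    have e1 := placeValuation_pointPullback P φ.nonsingular_pullback' φ.transcendental_pullbackX t
    have e2 := placeValuation_pointPullback (P + T) φ.nonsingular_pullback'
      φ.transcendental_pullbackX t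
    rw [hsP] at e1
    rw [hsPT, hφPT] at e2
    rw [← e1, ← e2, ← hΦ, ← placeValuation_transAlgHom_of_ne hP hPT hPT' hPT2 (Φ t),
      ← AlgHom.comp_apply, hfix]
  obtain ⟨a, b, hab, hQe⟩ := geomPoints.exists_eq_some hφP
  obtain ⟨π, hπ⟩ : ∃ π, placeValuation (W'.baseChange (AlgebraicClosure K)).toAffine (φ P) π =
      WithZero.exp (-1) := by
    rw [hQe, placeValuation_some]
    exact (pointPrime hab.left).valuation_exists_uniformizer _
  have := key π
  rw [hπ, ← WithZero.exp_nsmul, ← WithZero.exp_nsmul, WithZero.exp_inj, nsmul_eq_mul, nsmul_eq_mul,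
    mul_neg, mul_one, mul_neg, mul_one, neg_inj] at this
  exact_mod_cast this.symm

/-- **`#ker φ` divides `deg φ = d(φ(x, y))`**: for a generic `P₀`, the fibre of `φ(x, y)` over
`φ(P₀)` is the coset `P₀ + ker φ` and the ramification index is constant on it, so
`d(φ(x,y)) = D(φ P₀) = #ker φ · e(P₀)`. Silverman, *AEC*, Thm. III.4.10(a)
(`#ker φ = deg_s φ ∣ deg φ`). [folklore] -/
theorem Isogeny.card_ker_dvd_polarDegHom (φ : Isogeny W W') :
    (Nat.card φ.toAddMonoidHom.ker : ℤ) ∣ polarDegHom φ.toAddMonoidHom := by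
  classical
  set V := (W.baseChange (AlgebraicClosure K)).toAffine with hV
  set V' := (W'.baseChange (AlgebraicClosure K)).toAffine with hV'
  -- the exceptional set and the kernel
  set Bset : Set W.geomPoints := {P | ¬ AgreesWithRationalMapAt W W' φ.rationalRep.P₁
    φ.rationalRep.Q₁ φ.rationalRep.P₂ φ.rationalRep.Q₂ φ P} with hBset
  have hB : Bset.Finite := φ.rationalRep.finite
  have hBiff : ∀ {P}, P ∉ Bset ↔ AgreesWithRationalMapAt W W' φ.rationalRep.P₁
      φ.rationalRep.Q₁ φ.rationalRep.P₂ φ.rationalRep.Q₂ φ P := fun {P} ↦ by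
    rw [hBset, Set.mem_setOf_eq, not_not]
  set kerS : Set W.geomPoints := (φ.toAddMonoidHom.ker : Set W.geomPoints) with hkerS
  have hK : kerS.Finite := φ.finite_ker
  have hmemK : ∀ {T}, T ∈ kerS ↔ φ T = 0 := fun {T} ↦ by
    rw [hkerS, SetLike.mem_coe, AddMonoidHom.mem_ker, Isogeny.coe_toAddMonoidHom]
  -- the bad set for `P₀`
  set bad₁ : Set W.geomPoints := ⋃ T ∈ kerS, (fun Q ↦ Q - T) '' Bset with hbad₁
  have f₁ : bad₁.Finite := hK.biUnion fun T _ ↦ hB.image _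
  set S₁ : Set W'.geomPoints := (fun P ↦ specialize V V' P φ.genericLPoint) '' Bset with hS₁
  set bad₂ : Set W.geomPoints := ⋃ Q ∈ S₁, {P | φ P = Q} with hbad₂
  have f₂ : bad₂.Finite := (hB.image _).biUnion fun Q _ ↦ φ.finite_fibre Q
  set bad₃ : Set W.geomPoints := {0} ∪ kerS ∪ (fun T ↦ -(T + T)) '' kerS with hbad₃
  have f₃ : bad₃.Finite := ((Set.finite_singleton _).union hK).union (hK.image _)
  haveI : Infinite W.geomPoints := WeierstrassCurve.infinite_point (V := W.baseChange _)
  obtain ⟨P₀, hP₀⟩ := ((f₁.union f₂).union f₃).infinite_compl.nonempty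
  rw [Set.mem_compl_iff, Set.mem_union, Set.mem_union, not_or, not_or] at hP₀
  obtain ⟨⟨n₁, n₂⟩, n₃⟩ := hP₀
  -- unpacking the conditions
  have hP0 : P₀ ≠ 0 := fun h ↦ n₃ (Or.inl (Or.inl h))
  have hPker : P₀ ∉ kerS := fun h ↦ n₃ (Or.inl (Or.inr h))
  have hP2 : ∀ T ∈ kerS, P₀ ≠ -(T + T) := fun T hT h ↦ n₃ (Or.inr ⟨T, hT, h.symm⟩)
  have hφP : φ P₀ ≠ 0 := fun h ↦ hPker (hmemK.mpr h)
  have c₁ : ∀ T ∈ kerS, P₀ + T ∉ Bset := fun T hT hmem ↦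
    n₁ (Set.mem_biUnion hT ⟨P₀ + T, hmem, add_sub_cancel_right P₀ T⟩)
  have c₂ : ∀ P ∈ Bset, specialize V V' P φ.genericLPoint ≠ φ P₀ := fun P hP heq ↦
    n₂ (Set.mem_biUnion ⟨P, hP, heq⟩ rfl)
  have hP₀B : P₀ ∉ Bset := by simpa using c₁ 0 (hmemK.mpr (map_zero φ))
  -- the fibre over `φ P₀` is the coset `P₀ + ker φ`
  have hfib : ∀ P : W.geomPoints, specialize V V' P φ.genericLPoint = φ P₀ ↔
      ∃ T ∈ kerS, P₀ + T = P := by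
    intro P
    constructor
    · intro hP
      have hPB : P ∉ Bset := fun h ↦ c₂ P h hP
      rw [φ.specialize_genericLPoint (hBiff.mp hPB)] at hP
      refine ⟨P - P₀, hmemK.mpr ?_, add_sub_cancel P₀ P⟩
      rw [map_sub, hP, sub_self]
    · rintro ⟨T, hT, rfl⟩
      rw [φ.specialize_genericLPoint (hBiff.mp (c₁ T hT)), map_add, hmemK.mp hT, add_zero]
  -- ramification is constant on the coset
  have hram : ∀ T ∈ kerS, ramificationIdx V V' (P₀ + T) φ.nonsingular_pullback'
      φ.transcendental_pullbackX = ramificationIdx V V' P₀ φ.nonsingular_pullback'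
      φ.transcendental_pullbackX := by
    intro T hT
    refine φ.ramificationIdx_add_eq (hmemK.mp hT) hP0 (fun h ↦ hPker (h ▸ hT)) ?_ ?_ hφP
      (hBiff.mp hP₀B) (hBiff.mp (c₁ T hT))
    · intro h0
      have : P₀ = -T := eq_neg_of_add_eq_zero_left h0
      exact hPker (by rw [this]; exact hmemK.mpr (by rw [map_neg, hmemK.mp hT, neg_zero]))
    · intro h
      exact hP2 T hT (by
        have := congrArg (fun Q ↦ Q - T) h
        simpa [sub_eq_add_neg, add_assoc] using this)
  -- count: `d = D(φ P₀) = Σ_{T ∈ ker} e(P₀ + T) = #ker · e(P₀)`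
  have hdeg : polarDegHom φ.toAddMonoidHom = (fibreDegree V V' φ.nonsingular_pullback'
      φ.transcendental_pullbackX (φ P₀) : ℤ) := by
    unfold polarDegHom
    rw [homLPoint_toAddMonoidHom, Isogeny.genericLPoint_eq,
      polarDeg_some_of_transcendental _ φ.transcendental_pullbackX,
      fibreDegree_eq_fibreDegree_zero _ _ (φ P₀)]
  rw [hdeg, cast_fibreDegree]
  change (Nat.card φ.toAddMonoidHom.ker : ℤ) ∣ ∑ᶠ P : W.geomPoints,
    (if specialize V V' P φ.genericLPoint = φ P₀ then
      (ramificationIdx V V' P φ.nonsingular_pullback' φ.transcendental_pullbackX : ℤ) else 0)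
  set S : Finset W.geomPoints := hK.toFinset.image fun T ↦ P₀ + T with hS
  have hsupp : (Function.support fun P : W.geomPoints ↦
      (if specialize V V' P φ.genericLPoint = φ P₀ then
        (ramificationIdx V V' P φ.nonsingular_pullback' φ.transcendental_pullbackX : ℤ) else 0))
      ⊆ S := by
    intro P hP
    rw [Function.mem_support] at hP
    have hPQ : specialize V V' P φ.genericLPoint = φ P₀ := by
      by_contra h; exact hP (if_neg h)
    obtain ⟨T, hT, rfl⟩ := (hfib P).mp hPQ
    rw [hS, Finset.coe_image, Set.mem_image]
    exact ⟨T, (Set.Finite.mem_toFinset hK).mpr hT, rfl⟩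
  rw [finsum_eq_sum_of_support_subset _ hsupp, hS,
    Finset.sum_image fun T _ S _ h ↦ add_left_cancel h]
  rw [Finset.sum_congr rfl fun (T : W.geomPoints) hT ↦
    show (if specialize V V' (P₀ + T : W.geomPoints) φ.genericLPoint = φ P₀
      then (ramificationIdx V V' (P₀ + T : W.geomPoints) φ.nonsingular_pullback'
        φ.transcendental_pullbackX : ℤ)
      else 0) = ramificationIdx V V' P₀ φ.nonsingular_pullback' φ.transcendental_pullbackX by
    rw [if_pos ((hfib _).mpr ⟨T, (Set.Finite.mem_toFinset hK).mp hT, rfl⟩),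
      hram T ((Set.Finite.mem_toFinset hK).mp hT)]]
  rw [Finset.sum_const, nsmul_eq_mul]
  refine Dvd.intro (ramificationIdx V V' P₀ φ.nonsingular_pullback' φ.transcendental_pullbackX : ℤ)
    ?_
  congr 2
  change Nat.card kerS = hK.toFinset.card
  rw [Nat.card_coe_set_eq, Set.ncard_eq_toFinset_card _ hK]

end KernelTranslation

end WeierstrassCurve
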